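import Summits.AtomisticToContinuum.HydrodynamicLimit.Theorems.UGibbsSRBRigidityTemperedCollisionsTubeWeight
import Summits.AtomisticToContinuum.HydrodynamicLimit.Theorems.JParityClosureCollisionTightnessGibbsWindow
import HarnessLib

/-!
# `UGibbsSRBRigidity.TemperedCollisions` (stmt-AtomisticToContinuum-9391), step 2:
# the lifted pair weight — a measurable majorant of the collision mark with an `O(ε² h)` Haar integral

Helper file (`--supports stmt-AtomisticToContinuum-9391`).  For a window length `h ≥ 0` and sphere diameter
`ε > 0` on `𝕋³`, `exists_liftWeight` packages a jointly measurable weight `g(y, u) ∈ [0, ∞]` of a relative torus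
position `y = xᵢ − xⱼ` and a relative velocity `u = vᵢ − vⱼ` — the sum over the lifts `reprSym y + k`, `k ∈ ℤ³`,
of the weighted swept tube `𝟙_{S(u)} · ε/(‖u‖ a)` of step 1 — with the two properties the one-window argument
consumes:

* its Haar integral in `y` is at most `2π ε² h`, whatever `u` and the centre (the integer translates of the
  symmetric cube are disjoint, `disjoint_symCube_translates`; `Torus.measurePreserving_reprSym`;
  `lintegral_tube_weight_le`);
* it DOMINATES THE MARK `ε/|⟨n, vᵢ − vⱼ⟩|` of every contact reached by free flight within `[0, h]` from a
  non-overlapping pair (`exists_reprSym_freeFlight_eq`: the minimal image at the contact is a lift of the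
  initial one displaced by the flight; `mem_tube_of_contact`; and the normal component there is `‖u‖ a`,
  `abs_inner_add_smul_eq`).

References: C. Cercignani, R. Illner, M. Pulvirenti, *The Mathematical Theory of Dilute Gases* (1994), App. 4.A.
-/

noncomputable section

open MeasureTheory Set Filter Topology
open scoped ENNReal InnerProductSpace

namespace Summit.AtomisticToContinuum.HydrodynamicLimit.Theorems

open Literature.Analysis.FluidPDE Literature.MathematicalPhysics.KineticTheory
open Literature.Analysis.FunctionSpaces

/-! ### Lifting a free flight to `ℝ³`, as a vector identity -/

/-- **Lifting a free flight to `ℝ³`.** The minimal image of the relative position after the free flights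
`xᵢ + t vᵢ`, `xⱼ + t vⱼ` is a lift `reprSym (xᵢ − xⱼ) + k`, `k ∈ ℤ³`, of the initial one, displaced by
`t (vᵢ − vⱼ)` (vector form of `exists_lift_of_contact`). [folklore] -/
theorem exists_reprSym_freeFlight_eq (xi xj : T3) (vi vj : V3) (t : ℝ) :
    ∃ k : Fin 3 → ℤ, Torus.reprSym ((xi + Torus.proj (t • vi)) - (xj + Torus.proj (t • vj))) =
      Torus.reprSym (xi - xj) + Torus.latticeVec k + t • (vi - vj) := by
  set r : V3 := Torus.reprSym (xi - xj) with hr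
  set w : V3 := r + t • (vi - vj) with hw
  have hdiff : (xi + Torus.proj (t • vi)) - (xj + Torus.proj (t • vj)) = Torus.proj w := by
    have h1 : Torus.proj (t • vi) - Torus.proj (t • vj) = Torus.proj (t • vi - t • vj) := by
      rw [sub_eq_add_neg, ← Torus.proj_neg, ← Torus.proj_add, ← sub_eq_add_neg]
    have h2 : xi - xj = Torus.proj r := (Torus.proj_reprSym (xi - xj)).symm
    calc (xi + Torus.proj (t • vi)) - (xj + Torus.proj (t • vj))
        = (xi - xj) + (Torus.proj (t • vi) - Torus.proj (t • vj)) := by abel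
      _ = Torus.proj r + Torus.proj (t • vi - t • vj) := by rw [h1, h2]
      _ = Torus.proj w := by rw [hw, Torus.proj_add, smul_sub]
  obtain ⟨k, hk⟩ := (Torus.proj_eq_proj_iff_holds w (Torus.reprSym (Torus.proj w))).1
    (Torus.proj_reprSym (Torus.proj w)).symm
  refine ⟨k, ?_⟩
  rw [hdiff, hk, hw]
  abel

/-- **The normal component at the contact reached along a flight.** If `‖r + s u‖ = ε` then
`|⟪r + s u, u⟫| = ‖u‖ √(ε² − ‖p‖²)`, `p = r − ⟪r, û⟫ û` the offset across `u` (complete the square,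
`norm_add_smul_sq`; for `u = 0` both sides vanish). [folklore] -/
theorem abs_inner_add_smul_eq {ε : ℝ} {u r : V3} {s : ℝ} (hc : ‖r + s • u‖ = ε) :
    |⟪r + s • u, u⟫_ℝ| = ‖u‖ * Real.sqrt (ε ^ 2 - ‖r - ⟪r, ‖u‖⁻¹ • u⟫_ℝ • (‖u‖⁻¹ • u)‖ ^ 2) := by
  by_cases hu : u = 0
  · subst hu
    simp
  set lam := ⟪r, ‖u‖⁻¹ • u⟫_ℝ with hlam
  set p := r - lam • (‖u‖⁻¹ • u) with hp
  have hU : 0 < ‖u‖ := norm_pos_iff.2 hu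
  have key : ‖p‖ ^ 2 + (lam + s * ‖u‖) ^ 2 = ε ^ 2 := by
    rw [← norm_add_smul_sq hu r s, hc]
  have hsq : (lam + s * ‖u‖) ^ 2 = ε ^ 2 - ‖p‖ ^ 2 := by linarith
  have habs : |lam + s * ‖u‖| = Real.sqrt (ε ^ 2 - ‖p‖ ^ 2) := by
    rw [← hsq, Real.sqrt_sq_eq_abs]
  have hinner : ⟪r + s • u, u⟫_ℝ = ‖u‖ * (lam + s * ‖u‖) := by
    rw [hlam, inner_add_left, inner_smul_left, inner_smul_right, real_inner_self_eq_norm_sq]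
    simp only [RCLike.conj_to_real]
    field_simp
  rw [hinner, abs_mul, abs_norm, habs]

/-! ### The lifted pair weight -/

/-- **The lifted pair weight, packaged.** For `ε > 0` and `h ≥ 0` there is a jointly measurable weight
`g(y, u) ∈ [0, ∞]` of a relative torus position `y = xᵢ − xⱼ` and a relative velocity `u = vᵢ − vⱼ` — the sum over
the lifts `reprSym y + k`, `k ∈ ℤ³`, of the tube weight `𝟙_{S(u)} · ε/(‖u‖ a)` of the companion file — such that
(i) its Haar integral in `y` is at most the Lebesgue integral of the tube weight, `≤ 2π ε² h`, WHATEVER `u` and the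
centre (`volume_setOf_exists_reprSym_add_latticeVec_mem_le` for functions: the translates of the symmetric cube are
disjoint), and (ii) it DOMINATES THE MARK of every contact reached by free flight within `[0, h]` from a
non-overlapping pair: if `dist(xᵢ, xⱼ) ≥ ε` and `dist(xᵢ + s vᵢ, xⱼ + s vⱼ) = ε`, `s ∈ [0, h]`, then
`ε / |⟪n, vᵢ − vⱼ⟫| ≤ g(xᵢ − xⱼ, vᵢ − vⱼ)` for the minimal-image separation `n` at the contact (the lift of the
flight puts `reprSym (xᵢ − xⱼ) + k` in the tube, `mem_tube_of_contact`, and the normal component there is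
`‖u‖ a`, `abs_inner_add_smul_eq`). [folklore] -/
theorem exists_liftWeight {ε h : ℝ} (hε : 0 < ε) (hh : 0 ≤ h) :
    ∃ g : T3 → V3 → ℝ≥0∞, Measurable (Function.uncurry g) ∧
      (∀ (c : T3) (u : V3), ∫⁻ y, g (y - c) u ≤ ENNReal.ofReal (2 * Real.pi * ε ^ 2 * h)) ∧
      ∀ (xi xj : T3) (vi vj : V3) (s : ℝ), ε ≤ Torus.euclidDist xi xj → s ∈ Icc 0 h →
        Torus.euclidDist (xi + Torus.proj (s • vi)) (xj + Torus.proj (s • vj)) = ε →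
        ENNReal.ofReal (ε / |⟪Torus.reprSym ((xi + Torus.proj (s • vi)) - (xj + Torus.proj (s • vj))),
            vi - vj⟫_ℝ|) ≤ g (xi - xj) (vi - vj) := by
  -- the tube, its weight, and the joint integrand on `ℝ³ × ℝ³`
  set S : V3 → Set V3 := fun u => {r : V3 | ‖r - ⟪r, ‖u‖⁻¹ • u⟫_ℝ • (‖u‖⁻¹ • u)‖ ≤ ε ∧
      (⟪r, ‖u‖⁻¹ • u⟫_ℝ ∈
          Icc (-Real.sqrt (ε ^ 2 - ‖r - ⟪r, ‖u‖⁻¹ • u⟫_ℝ • (‖u‖⁻¹ • u)‖ ^ 2) - h * ‖u‖)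
            (-Real.sqrt (ε ^ 2 - ‖r - ⟪r, ‖u‖⁻¹ • u⟫_ℝ • (‖u‖⁻¹ • u)‖ ^ 2)) ∨
        ⟪r, ‖u‖⁻¹ • u⟫_ℝ = Real.sqrt (ε ^ 2 - ‖r - ⟪r, ‖u‖⁻¹ • u⟫_ℝ • (‖u‖⁻¹ • u)‖ ^ 2))} with hS
  set wt : V3 → V3 → ℝ≥0∞ := fun r u => ENNReal.ofReal
      (ε / (‖u‖ * Real.sqrt (ε ^ 2 - ‖r - ⟪r, ‖u‖⁻¹ • u⟫_ℝ • (‖u‖⁻¹ • u)‖ ^ 2))) with hwt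
  set G : V3 × V3 → ℝ≥0∞ := fun q => {q : V3 × V3 | q.1 ∈ S q.2}.indicator (fun q => wt q.1 q.2) q with hG
  have hSm : MeasurableSet {q : V3 × V3 | q.1 ∈ S q.2} := by
    rw [hS]
    exact measurableSet_tube_prod ε h
  have hwtm : Measurable fun q : V3 × V3 => wt q.1 q.2 := by
    rw [hwt]
    exact (by fun_prop : Measurable fun q : V3 × V3 =>
      ε / (‖q.2‖ * Real.sqrt (ε ^ 2 - ‖q.1 - ⟪q.1, ‖q.2‖⁻¹ • q.2⟫_ℝ • (‖q.2‖⁻¹ • q.2)‖ ^ 2))).ennreal_ofReal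
  have hGm : Measurable G := hwtm.indicator hSm
  -- sections in `r`
  have hGsec : ∀ u, (fun r => G (r, u)) = (S u).indicator fun r => wt r u := by
    intro u
    funext r
    simp only [hG, Set.indicator, mem_setOf_eq]
  have hGsec_int : ∀ u, ∫⁻ r, G (r, u) ≤ ENNReal.ofReal (2 * Real.pi * ε ^ 2 * h) := by
    intro u
    rw [hGsec u]
    exact lintegral_tube_weight_le hε hh u
  -- the lifted weight
  refine ⟨fun y u => ∑' k : Fin 3 → ℤ, G (Torus.reprSym y + Torus.latticeVec k, u), ?_, ?_, ?_⟩
  · -- (0) joint measurability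
    refine Measurable.tsum fun k => hGm.comp ?_
    exact ((Torus.measurable_reprSym.comp measurable_fst).add_const _).prodMk measurable_snd
  · -- (i) the Haar integral
    intro c u
    set Q : Set V3 := Torus.symCube (Fin 3) with hQ
    set Qk : (Fin 3 → ℤ) → Set V3 := fun k => (fun r : V3 => r - Torus.latticeVec k) ⁻¹' Q with hQk
    have hQm : MeasurableSet Q := Torus.measurableSet_symCube
    have hQkm : ∀ k, MeasurableSet (Qk k) := fun k => hQm.preimage (measurable_sub_const _)
    have hGum : Measurable fun r => G (r, u) := hGm.comp (measurable_id.prodMk measurable_const)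
    have hterm : ∀ k : Fin 3 → ℤ,
        ∫⁻ y : T3, G (Torus.reprSym (y - c) + Torus.latticeVec k, u) = ∫⁻ r in Qk k, G (r, u) := by
      intro k
      have hmp : MeasurePreserving (fun y : T3 => Torus.reprSym (y - c)) volume (volume.restrict Q) :=
        Torus.measurePreserving_reprSym.comp (measurePreserving_sub_right volume c)
      have hgk : Measurable fun r : V3 => G (r + Torus.latticeVec k, u) :=
        hGum.comp (measurable_add_const _)
      rw [hmp.lintegral_comp hgk]
      -- translate by `k`
      have hind : ∀ r : V3, Q.indicator (fun r => G (r + Torus.latticeVec k, u)) r =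
          (Qk k).indicator (fun r => G (r, u)) (r + Torus.latticeVec k) := by
        intro r
        have hiff : r ∈ Q ↔ r + Torus.latticeVec k ∈ Qk k := by
          simp only [hQk, mem_preimage, add_sub_cancel_right]
        by_cases hr : r ∈ Q
        · rw [indicator_of_mem hr, indicator_of_mem (hiff.1 hr)]
        · rw [indicator_of_notMem hr, indicator_of_notMem (mt hiff.2 hr)]
      rw [← lintegral_indicator hQm, funext hind,
        lintegral_add_right_eq_self (fun r => (Qk k).indicator (fun r => G (r, u)) r) (Torus.latticeVec k),
        lintegral_indicator (hQkm k)]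
    have hdisj : Pairwise (Function.onFun Disjoint Qk) := fun k l hkl => disjoint_symCube_translates hkl
    calc ∫⁻ y : T3, ∑' k : Fin 3 → ℤ, G (Torus.reprSym (y - c) + Torus.latticeVec k, u)
        = ∑' k : Fin 3 → ℤ, ∫⁻ y : T3, G (Torus.reprSym (y - c) + Torus.latticeVec k, u) := by
          refine lintegral_tsum fun k => (hGum.comp ?_).aemeasurable
          exact (Torus.measurable_reprSym.comp (measurable_id.sub measurable_const)).add_const _
      _ = ∑' k : Fin 3 → ℤ, ∫⁻ r in Qk k, G (r, u) := by simp_rw [hterm]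
      _ = ∫⁻ r in ⋃ k, Qk k, G (r, u) := (lintegral_iUnion hQkm hdisj _).symm
      _ ≤ ∫⁻ r, G (r, u) := setLIntegral_le_lintegral _ _
      _ ≤ ENNReal.ofReal (2 * Real.pi * ε ^ 2 * h) := hGsec_int u
  · -- (ii) domination of the mark
    intro xi xj vi vj s hD hs hcontact
    obtain ⟨k, hk⟩ := exists_reprSym_freeFlight_eq xi xj vi vj s
    set rt : V3 := Torus.reprSym (xi - xj) + Torus.latticeVec k with hrt
    have hn : ‖rt + s • (vi - vj)‖ = ε := by
      rw [← hk]
      exact hcontact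
    have hproj : Torus.proj rt = xi - xj := by
      rw [hrt, Torus.proj_add_latticeVec, Torus.proj_reprSym]
    have hr : ε ≤ ‖rt‖ := hD.trans (Torus.norm_reprSym_le_of_proj_eq hproj)
    have hmem : rt ∈ S (vi - vj) := mem_tube_of_contact hε.le hr hs hn
    have hval : ENNReal.ofReal (ε / |⟪Torus.reprSym ((xi + Torus.proj (s • vi)) - (xj + Torus.proj (s • vj))),
        vi - vj⟫_ℝ|) = G (rt, vi - vj) := by
      rw [hk, abs_inner_add_smul_eq hn, hG]
      simp only [Set.indicator, mem_setOf_eq]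
      rw [if_pos hmem]
    rw [hval]
    exact ENNReal.le_tsum k


end Summit.AtomisticToContinuum.HydrodynamicLimit.Theorems

end
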